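import Literature.MathematicalPhysics.KineticTheory.HardSphereCampbellLowerBoundMesh
import Literature.MathematicalPhysics.KineticTheory.HardSphereCampbellUpperBound
import Literature.MathematicalPhysics.KineticTheory.HardSphereCampbellStrictFlux
import HarnessLib

/-!
# `HardSphereCampbellFormula` holds

DISCHARGE of the named fact `HardSphereCampbellFormula` (`HardSphereCollisionCampbell`): the
stationary collision-rate (Campbell / special-flow) identity for hard spheres on the torus
(Cercignani–Illner–Pulvirenti 1994, App. 4.A pp. 107–111: in the special flow representation over the
collision boundary "the Lebesgue measure becomes `dσ dt`") — for `0 < ε < 1/2`, every hard-sphere flow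
structure `Φ` on `(T^d × ℝ^d)^N`, every measurable mark `g ≥ 0` and every `τ`,
`∫ Σ_{s ∈ (0,τ]} Σ_{(i,j) ∈ contactPairs(Φ_s z)} g(Φ_s z, i, j) dz = τ · outgoingCollisionFlux ε N g`
(`hardSphereCampbellFormula_holds`).

This file supplies the LOWER bound `campbell_lowerBound` and assembles: the lower bound at a fixed
mesh (`campbell_lowerBound_mesh`) is released by monotone convergence, first in the mesh (the
"others farther than `ε + 8Vδ`" restriction increases to "others farther than `ε`",
`campbell_iSup_lintegral_setFlux`), then in the speed bound `V → ∞`; the remaining restriction differs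
from the hard-core indicator `1_{D_ε}` of the flux by the flux-null event "another pair at distance
exactly `ε`" (`pairFlux_otherContact_null`, `campbell_pairFlux_le_strictFlux`); the sum over unordered
pairs is the outgoing flux (`outgoingCollisionFlux_eq_sum_lt`). With the sharp upper bound
`campbell_upperBound` and the a.e.-measurability `aemeasurable_collisionPairSum`, the tree's assembly
`hardSphereCampbellFormula_dim_of` (sandwich on energy shells + monotone convergence in the mark)
gives the identity.

## References

* C. Cercignani, R. Illner, M. Pulvirenti, *The Mathematical Theory of Dilute Gases*, Springer
  (1994), §4.2, App. 4.A pp. 107–111.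
* I. Gallagher, L. Saint-Raymond, B. Texier, *From Newton to Boltzmann*, EMS (2013), proof of
  Prop. 4.1.1 p. 19.
* A. F. Karr, *Point Processes and Their Statistical Inference* (1991), Prop. 1.63 (Campbell formula).
-/

open MeasureTheory Set Function Filter Metric Topology
open scoped ENNReal NNReal RealInnerProductSpace

namespace Literature.MathematicalPhysics.KineticTheory

open Literature.Analysis.FluidPDE

noncomputable section

variable {d : Type*} [Fintype d] {N : ℕ} {ε : ℝ}

/-! ### The lower bound -/

/-- **`LB`: the lower bound of the Campbell identity.** For `0 < ε < 1/2`, a hard-sphere flow structure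
`Φ` on `(T^d × ℝ^d)^N`, a measurable mark `g ≥ 0` and `τ > 0`:
`τ · outgoingCollisionFlux ε N g ≤ ∫ CPS_{(0,τ]}(g) dLiouville`. The bound at a fixed mesh
(`campbell_lowerBound_mesh`) is released by monotone convergence in the mesh and in the speed bound,
and the strict "others farther than `ε`" restriction is flux-a.e. the hard-core indicator.
[cite: CIP1994, App. 4.A pp. 107–111] -/
theorem campbell_lowerBound (d : Type*) [Fintype d] (N : ℕ) (ε : ℝ) (hε : 0 < ε) (hε' : ε < 1 / 2)
    (Φ : HardSphereFlow (Torus.geometry d) ε N)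
    (g : Config N d (UnitAddTorus d) → Fin N → Fin N → ℝ≥0∞) (hg : ∀ i j, Measurable fun w => g w i j)
    (τ : ℝ) (hτ : 0 < τ) :
    ENNReal.ofReal τ * outgoingCollisionFlux ε N g ≤
      ∫⁻ z, Φ.collisionPairSum (Ioc 0 τ) (fun _ w i j => g w i j) z ∂(liouville (Torus.geometry d) N ε) := by
  have hε2 : ε < 2⁻¹ := by rw [inv_eq_one_div]; exact hε'
  have hG : ∀ a b : Fin N, Measurable fun w : Config N d (UnitAddTorus d) => g w a b + g w b a :=
    fun a b => (hg a b).add (hg b a)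
  -- the restricted fluxes
  set ρ : ℕ → ℕ → ℝ := fun n m => 2 * (2 * (n : ℝ) * (τ / ((m : ℝ) + 1))) with hρdef
  set S : Fin N → Fin N → ℕ → ℕ → ℝ≥0∞ := fun a b n m =>
    ∫⁻ z : Config N d (UnitAddTorus d), ∫⁻ ω : Metric.sphere (0 : EuclideanSpace ℝ d) 1,
      ENNReal.ofReal (ε ^ (Fintype.card d - 1) * ⟪((ω : EuclideanSpace ℝ d)), (z a).2 - (z b).2⟫) *
        {w : Config N d (UnitAddTorus d) | configEnergy w ≤ (n : ℝ) ^ 2 / 2 ∧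
            Alexander.OthersFar ε (ρ n m) w a b}.indicator
          (fun w => g w a b + g w b a) (contactInsert ε a b (ω : EuclideanSpace ℝ d) z)
      ∂(volume : Measure (EuclideanSpace ℝ d)).toSphere with hSdef
  set Sn : Fin N → Fin N → ℕ → ℝ≥0∞ := fun a b n =>
    ∫⁻ z : Config N d (UnitAddTorus d), ∫⁻ ω : Metric.sphere (0 : EuclideanSpace ℝ d) 1,
      ENNReal.ofReal (ε ^ (Fintype.card d - 1) * ⟪((ω : EuclideanSpace ℝ d)), (z a).2 - (z b).2⟫) *
        {w : Config N d (UnitAddTorus d) | configEnergy w ≤ (n : ℝ) ^ 2 / 2 ∧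
            Alexander.OthersFar ε 0 w a b}.indicator
          (fun w => g w a b + g w b a) (contactInsert ε a b (ω : EuclideanSpace ℝ d) z)
      ∂(volume : Measure (EuclideanSpace ℝ d)).toSphere with hSndef
  set Sfull : Fin N → Fin N → ℝ≥0∞ := fun a b =>
    ∫⁻ z : Config N d (UnitAddTorus d), ∫⁻ ω : Metric.sphere (0 : EuclideanSpace ℝ d) 1,
      ENNReal.ofReal (ε ^ (Fintype.card d - 1) * ⟪((ω : EuclideanSpace ℝ d)), (z a).2 - (z b).2⟫) *
        {w : Config N d (UnitAddTorus d) | Alexander.OthersFar ε 0 w a b}.indicator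
          (fun w => g w a b + g w b a) (contactInsert ε a b (ω : EuclideanSpace ℝ d) z)
      ∂(volume : Measure (EuclideanSpace ℝ d)).toSphere with hSfulldef
  set I : ℝ≥0∞ := ∫⁻ z, Φ.collisionPairSum (Ioc 0 τ) (fun _ w i j => g w i j) z
    ∂(liouville (Torus.geometry d) N ε) with hIdef
  -- monotonicity of `ρ` and of the restricted sets
  have hρ_nonneg : ∀ n m, 0 ≤ ρ n m := fun n m => by simp only [hρdef]; positivity
  have hρ_anti : ∀ n, Antitone (ρ n) := by
    intro n i j hij
    simp only [hρdef]
    have hi : (0 : ℝ) < (i : ℝ) + 1 := by positivity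
    have hij' : (i : ℝ) + 1 ≤ (j : ℝ) + 1 := by exact_mod_cast Nat.succ_le_succ hij
    have : τ / ((j : ℝ) + 1) ≤ τ / ((i : ℝ) + 1) := div_le_div_of_nonneg_left hτ.le hi hij'
    nlinarith [Nat.cast_nonneg (α := ℝ) n]
  have hset_meas : ∀ (a b : Fin N) (c r : ℝ), MeasurableSet {w : Config N d (UnitAddTorus d) |
      configEnergy w ≤ c ∧ Alexander.OthersFar ε r w a b} := fun a b c r =>
    (Alexander.measurableSet_energyShell c).inter (Alexander.measurableSet_othersFar ε r a b)
  -- (1) the mesh bound, for every `n` and `m`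
  have hmesh : ∀ n m : ℕ, ENNReal.ofReal τ * ∑ a : Fin N, ∑ b : Fin N,
      (if a < b then S a b n m else 0) ≤ I := by
    intro n m
    have hV : (0 : ℝ) ≤ (n : ℝ) := Nat.cast_nonneg n
    obtain ⟨m₀, hm₀⟩ := (Alexander.eventually_chart hε2 (n : ℝ) τ).exists_forall_of_atTop
    set m' := max m m₀ with hm'
    have hch : ε + 2 * (2 * (n : ℝ) * (τ / ((m' : ℝ) + 1))) < 2⁻¹ := hm₀ m' (le_max_right _ _)
    have hkey := campbell_lowerBound_mesh hε hε' Φ hg hτ hV m' hch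
    refine le_trans (mul_le_mul' le_rfl (Finset.sum_le_sum fun a _ => Finset.sum_le_sum fun b _ => ?_)) hkey
    by_cases hab : a < b
    · rw [if_pos hab, if_pos hab]
      simp only [hSdef]
      refine lintegral_mono fun z => lintegral_mono fun ω => mul_le_mul' le_rfl ?_
      refine indicator_le_indicator_of_subset ?_ (fun _ => zero_le) _
      intro w hw
      refine ⟨hw.1, fun k l hkl hne => ?_⟩
      have h := hw.2 k l hkl hne
      have hρle : ρ n m' ≤ ρ n m := hρ_anti n (le_max_left _ _)
      simp only [hρdef] at hρle
      linarith
    · rw [if_neg hab, if_neg hab]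
  -- (2) release the mesh: `⨆ₘ S a b n m = Sn a b n`
  have hsupm : ∀ (a b : Fin N) (n : ℕ), (⨆ m, S a b n m) = Sn a b n := by
    intro a b n
    simp only [hSdef, hSndef]
    have hTmono : Monotone (fun m => {w : Config N d (UnitAddTorus d) | configEnergy w ≤ (n : ℝ) ^ 2 / 2 ∧
        Alexander.OthersFar ε (ρ n m) w a b}) := by
      intro i j hij w hw
      refine ⟨hw.1, fun k l hkl hne => ?_⟩
      have h := hw.2 k l hkl hne
      have := hρ_anti n hij
      linarith
    refine campbell_iSup_lintegral_setFlux ε a b (hG a b)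
      (fun m => {w : Config N d (UnitAddTorus d) | configEnergy w ≤ (n : ℝ) ^ 2 / 2 ∧
        Alexander.OthersFar ε (ρ n m) w a b}) (fun m => hset_meas a b _ _) hTmono
      {w : Config N d (UnitAddTorus d) | configEnergy w ≤ (n : ℝ) ^ 2 / 2 ∧ Alexander.OthersFar ε 0 w a b}
      (fun x => ⟨fun hx => ?_, ?_⟩)
    · -- eventually in `m` every strict inequality has room `ρ n m`
      have hρ0 : Tendsto (ρ n) atTop (𝓝 0) := by
        have h := (tendsto_one_div_add_atTop_nhds_zero_nat (𝕜 := ℝ)).const_mul (4 * (n : ℝ) * τ)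
        rw [mul_zero] at h
        refine h.congr fun m => ?_
        simp only [hρdef]
        ring
      have hev : ∀ᶠ m in atTop, ∀ k : Fin N, ∀ l : Fin N, k ≠ l → ({k, l} : Finset (Fin N)) ≠ {a, b} →
          ε + ρ n m < ‖(Torus.geometry d).sepVec (x k).1 (x l).1‖ := by
        refine Filter.eventually_all.2 fun k => Filter.eventually_all.2 fun l => ?_
        by_cases hkl : k ≠ l ∧ ({k, l} : Finset (Fin N)) ≠ {a, b}
        · have hlt : ε + 0 < ‖(Torus.geometry d).sepVec (x k).1 (x l).1‖ := hx.2 k l hkl.1 hkl.2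
          have ht : Tendsto (fun m => ε + ρ n m) atTop (𝓝 (ε + 0)) := tendsto_const_nhds.add hρ0
          exact (ht.eventually_lt_const hlt).mono fun m hm _ _ => hm
        · exact Filter.Eventually.of_forall fun m h1 h2 => absurd (And.intro h1 h2) hkl
      obtain ⟨m, hm⟩ := hev.exists
      exact ⟨m, hx.1, hm⟩
    · rintro ⟨m, hm⟩
      exact ⟨hm.1, fun k l hkl hne => by have := hm.2 k l hkl hne; linarith [hρ_nonneg n m]⟩
  have hSn : ∀ n : ℕ, ENNReal.ofReal τ * ∑ a : Fin N, ∑ b : Fin N, (if a < b then Sn a b n else 0) ≤ I := by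
    intro n
    have hmono : ∀ a b : Fin N, Monotone fun m => (if a < b then S a b n m else 0) := by
      intro a b i j hij
      by_cases hab : a < b
      · simp only [if_pos hab, hSdef]
        refine lintegral_mono fun z => lintegral_mono fun ω => mul_le_mul' le_rfl ?_
        refine indicator_le_indicator_of_subset ?_ (fun _ => zero_le) _
        intro w hw
        refine ⟨hw.1, fun k l hkl hne => ?_⟩
        have h := hw.2 k l hkl hne
        have := hρ_anti n hij
        linarith
      · simp only [if_neg hab]; exact le_rfl
    have heq : (∑ a : Fin N, ∑ b : Fin N, (if a < b then Sn a b n else 0)) =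
        ⨆ m, ∑ a : Fin N, ∑ b : Fin N, (if a < b then S a b n m else 0) := by
      rw [← ENNReal.finsetSum_iSup_of_monotone fun a => ?_]
      · refine Finset.sum_congr rfl fun a _ => ?_
        rw [← ENNReal.finsetSum_iSup_of_monotone fun b => hmono a b]
        refine Finset.sum_congr rfl fun b _ => ?_
        by_cases hab : a < b
        · simp only [if_pos hab, hsupm]
        · simp only [if_neg hab, iSup_const]
      · intro i j hij
        exact Finset.sum_le_sum fun b _ => hmono a b hij
    rw [heq, ENNReal.mul_iSup]
    exact iSup_le fun m => hmesh n m
  -- (3) release the speed bound: `⨆ₙ Sn a b n = Sfull a b`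
  have hsupn : ∀ a b : Fin N, (⨆ n, Sn a b n) = Sfull a b := by
    intro a b
    simp only [hSndef, hSfulldef]
    have hTmono : Monotone (fun n : ℕ => {w : Config N d (UnitAddTorus d) |
        configEnergy w ≤ (n : ℝ) ^ 2 / 2 ∧ Alexander.OthersFar ε 0 w a b}) := by
      intro i j hij w hw
      refine ⟨hw.1.trans ?_, hw.2⟩
      have : (i : ℝ) ≤ (j : ℝ) := by exact_mod_cast hij
      have hi : (0 : ℝ) ≤ (i : ℝ) := Nat.cast_nonneg i
      nlinarith
    have h := campbell_iSup_lintegral_setFlux ε a b (hG a b)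
      (fun n : ℕ => {w : Config N d (UnitAddTorus d) | configEnergy w ≤ (n : ℝ) ^ 2 / 2 ∧ Alexander.OthersFar ε 0 w a b})
      (fun n => hset_meas a b _ _) hTmono
      {w | Alexander.OthersFar ε 0 w a b} (fun x => ⟨fun hx => ?_, fun ⟨n, hn⟩ => hn.2⟩)
    · exact h
    · obtain ⟨n, hn⟩ := exists_nat_ge (2 * configEnergy x + 1)
      refine ⟨n, ?_, hx⟩
      show configEnergy x ≤ (n : ℝ) ^ 2 / 2
      have hE : 0 ≤ configEnergy x := by unfold configEnergy; positivity
      nlinarith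
  have hfull : ENNReal.ofReal τ * ∑ a : Fin N, ∑ b : Fin N, (if a < b then Sfull a b else 0) ≤ I := by
    have hmono : ∀ a b : Fin N, Monotone fun n => (if a < b then Sn a b n else 0) := by
      intro a b i j hij
      by_cases hab : a < b
      · simp only [if_pos hab, hSndef]
        refine lintegral_mono fun z => lintegral_mono fun ω => mul_le_mul' le_rfl ?_
        refine indicator_le_indicator_of_subset ?_ (fun _ => zero_le) _
        intro w hw
        refine ⟨hw.1.trans ?_, hw.2⟩
        have : (i : ℝ) ≤ (j : ℝ) := by exact_mod_cast hij
        have hi : (0 : ℝ) ≤ (i : ℝ) := Nat.cast_nonneg i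
        nlinarith
      · simp only [if_neg hab]; exact le_rfl
    have heq : (∑ a : Fin N, ∑ b : Fin N, (if a < b then Sfull a b else 0)) =
        ⨆ n, ∑ a : Fin N, ∑ b : Fin N, (if a < b then Sn a b n else 0) := by
      rw [← ENNReal.finsetSum_iSup_of_monotone fun a => ?_]
      · refine Finset.sum_congr rfl fun a _ => ?_
        rw [← ENNReal.finsetSum_iSup_of_monotone fun b => hmono a b]
        refine Finset.sum_congr rfl fun b _ => ?_
        by_cases hab : a < b
        · simp only [if_pos hab, hsupn]
        · simp only [if_neg hab, iSup_const]
      · intro i j hij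
        exact Finset.sum_le_sum fun b _ => hmono a b hij
    rw [heq, ENNReal.mul_iSup]
    exact iSup_le fun n => hSn n
  -- (4) the hard-core indicator is flux-a.e. the strict one; regroup the pairs
  rw [outgoingCollisionFlux_eq_sum_lt hε.le hε' hg]
  refine le_trans (mul_le_mul' le_rfl (Finset.sum_le_sum fun a _ => Finset.sum_le_sum fun b _ => ?_)) hfull
  by_cases hab : a < b
  · rw [if_pos hab, if_pos hab]
    exact campbell_pairFlux_le_strictFlux hε (hG a b)
  · rw [if_neg hab, if_neg hab]

/-! ### The identity -/

/-- **`HardSphereCampbellFormula` HOLDS** — the stationary collision-rate (Campbell / special-flow)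
identity for hard spheres on the torus (Cercignani–Illner–Pulvirenti 1994, App. 4.A pp. 107–111): for
`0 < ε < 1/2`, every hard-sphere flow structure `Φ` on `(T^d × ℝ^d)^N`, every measurable mark `g ≥ 0`
of (phase point, ordered pair) and every `τ`,
`∫ Σ_{s ∈ (0,τ]} Σ_{(i,j) ∈ contactPairs(Φ_s z)} g(Φ_s z, i, j) dLiouville(z) = τ · outgoingCollisionFlux ε N g`.
Assembly `hardSphereCampbellFormula_dim_of` of the lower bound `campbell_lowerBound`, the sharp upper
bound `campbell_upperBound` and the a.e.-measurability `aemeasurable_collisionPairSum`.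
[cite: CIP1994, App. 4.A pp. 107–111] -/
theorem hardSphereCampbellFormula_holds : HardSphereCampbellFormula := by
  intro d _ N ε hε hε' Φ g hg τ
  exact hardSphereCampbellFormula_dim_of d
    (fun N ε hε hε' Φ g hg τ hτ => campbell_lowerBound d N ε hε hε' Φ g hg τ hτ)
    (fun N ε hε hε' Φ E₀ c τ hτ => campbell_upperBound d N ε hε hε' Φ E₀ c τ hτ)
    (fun N ε hε hε' Φ g hg τ => aemeasurable_collisionPairSum hε hε' Φ g hg τ)
    N ε hε hε' Φ g hg τ

end

end Literature.MathematicalPhysics.KineticTheory
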